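import Summits.CriticalPhenomena.CardyFormulaZ2.Theses.CardySelfRefinement
import Summits.CriticalPhenomena.CardyFormulaZ2.Theorems.LagHandOff.Negative.KillTemplates
import Literature.Probability.LatticeModels.DobrushinDiscretisation
import Literature.Probability.RandomPlanarGeometry.ChordalReversibility
import Literature.Probability.Percolation.QuadCrossingSpaceZ2
import Literature.Probability.Percolation.QuadCrossingSubseqLimits
import HarnessLib

/-!
# `LagHandOff` (stmt-CriticalPhenomena-10268), line `crosscut-dictionary`: the wiring-swap
# ("ArcSwap") obligation hidden in `stub_freeAxioms` and `stub_markovPassage` — part 1, the twin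

Refuter `drefute` (g2), negative-side consequence lemmas for the registered stubs of the skeleton
`Cruxes/LagHandOff/Lines/crosscut-dictionary.lean` (finding first recorded by drefute g1,
`Cruxes/LagHandOff/DrefuteFreeAxioms.md` + `DrefuteArcSwap.lean`; here made importable, def-free,
and pushed down to statements about bond-`ℤ²` interface statistics).  Part 2
(`Negative/ArcSwapStubs.lean`) feeds the registered statements of STUBS 6 and 7 verbatim.

What is proved (no statement of the route is asserted positively; nothing is refuted):

* `exists_orientationReversed` — every Dobrushin domain `(D; a, b)` has a TWIN `D'`: the same
  carrier, the same marked points `a`, `b`, the boundary loop run backwards, so that the two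
  boundary arcs are EXCHANGED (`D'.arc 0 = D.arc 1`, `D'.arc 1 = D.arc 0`).  (Orientation
  reversal; cf. the tree's `MarkedDomain.swap = (D; b, a)`, which exchanges the points instead.)
* `IsDomainMarkov` ALONE (clauses `initial` + `domain`; inlined in
  `wiringSwap_sameLimit_of_isDomainMarkov`, cf. crux 0698's
  `CardyRotToConfR2SymmetryUpgrade.Negative.eq_of_isDomainMarkov_of_carrier_eq`) and `IsLocal`
  ALONE (`eq_of_isLocal_of_carrier_eq`, `Negative/KillTemplates.lean`) each force `P D' = P D` for
  two Dobrushin structures with the same `(carrier, a, b)`.  So each of the two conclusions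
  `IsLocal` (STUB 6) and `IsDomainMarkov` (STUB 7) makes the decoded family `D ↦ (Ψ D)_* μ` blind
  to WHICH boundary arc is wired.
* `zdDiscretisationFamily_arcSwap` — exchanging the two data arcs of a `ℤ²`-discretisation family
  of `D` gives a `ℤ²`-discretisation family of the twin `D'` (admissibility is symmetric in the
  arcs); `bondInterfaceIn_eq_of_pt_eq` — the interface map reads the Dobrushin structure only
  through `a`, `b`.  Hence the hands-off hypothesis of the stubs (joint convergence for EVERY
  Dobrushin domain and EVERY admissible family), applied to `(D', swapped data)`, pins
  `(Ψ D')_* μ` to the limit law of the bond-`ℤ²` exploration of `D` WITH THE WIRING SWAPPED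
  (`(ba)` wired open, `(ab)` dual-wired), while `(Ψ D)_* μ` is the `(ab)`-wired limit
  (`tendsto_stat_of_handsOff`, `tendsto_swappedStat_of_handsOff`).
* `wiringSwap_sameLimit_of_map_eq / _of_isLocal / _of_isDomainMarkov` — consequently, if the
  decoded family is local (resp. domain Markov), the `(ab)`-wired and the `(ba)`-wired interface
  statistics `∫ g (bondInterfaceIn D (E δₙ) ·) dPerc` of every admissible family have the SAME
  limit along every quad-convergent mesh sequence.  This is a universality statement about
  bond-`ℤ²` (on the lattice it is planar self-duality, which lands on the DUAL lattice
  `δℤ² + δ(1+i)/2`, i.e. on a half-mesh TRANSLATE of the domain), not an exact identity on `δℤ²`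
  and not among the ingredients the docstrings of STUBS 6–7 list; the hands-off field of
  `IsCrosscutDictionary` (unshifted lattice, `Ω_eq` exact) does not supply it.  Believed true
  (consistent with an SLE₆ limit); recorded so that the lead budgets it (repairs R1/R2 of
  `DrefuteFreeAxioms.md`: an explicit `ArcSwap` stub, or hands-off at lattice offsets).

References: W. Werner, Lectures on two-dimensional critical percolation (2007) §3.2;
G. Lawler, O. Schramm, W. Werner, Electron. J. Probab. 7 (2001) Cor. 2.3–2.4 (locality);
S. Smirnov, ICM 2006 §2.1 (bond-`ℤ²` exploration, self-duality).
-/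

noncomputable section

open MeasureTheory Filter Set Topology
open scoped BoundedContinuousFunction
open Literature.Probability.Percolation Literature.Probability.LatticeModels
open Literature.Probability.RandomPlanarGeometry Literature.Probability.Percolation.QuadCrossing
open Summit.CriticalPhenomena.CardyFormulaZ2.Theses.CardySelfRefinement

namespace Summit.CriticalPhenomena.CardyFormulaZ2.Theorems.LagHandOff.Negative

/-! ### Orientation reversal of a Dobrushin domain (def-free existence) -/

/-- Equal boundary points have parameters differing by an integer (the loop only sees the
fractional part of the parameter, and is injective on one period). [folklore] -/
theorem exists_int_of_boundary_eq (D : JordanDomain) {s t : ℝ} (h : D.boundary s = D.boundary t) :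
    ∃ z : ℤ, s - t = z := by
  have hf : ∀ u : ℝ, D.boundary (Int.fract u) = D.boundary u := fun u => by
    rw [← Int.self_sub_floor]
    simpa using D.periodic_boundary.sub_int_mul_eq ⌊u⌋ (x := u)
  rw [← hf s, ← hf t] at h
  have hs : Int.fract s ∈ Ico (0 : ℝ) 1 := ⟨Int.fract_nonneg s, Int.fract_lt_one s⟩
  have ht : Int.fract t ∈ Ico (0 : ℝ) 1 := ⟨Int.fract_nonneg t, Int.fract_lt_one t⟩
  exact Int.fract_eq_fract.1 (D.injOn_boundary hs ht h)

/-- Shifting a parameter interval by the period does not change its image on the boundary.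
[folklore] -/
theorem image_boundary_Icc_add_one (D : JordanDomain) (u v : ℝ) :
    D.boundary '' Icc u v = D.boundary '' Icc (u + 1) (v + 1) := by
  rw [← image_add_const_Icc, image_image]
  exact image_congr fun x _ => (D.periodic_boundary x).symm

/-- **Orientation reversal exists.** Every Dobrushin domain `(D; a, b)` has a twin Dobrushin
structure with the same carrier and the same marked points `a = pt 0`, `b = pt 1` whose boundary
arcs are exchanged: the wired arc `(ab) = arc 0` of the twin is the dual-wired arc `(ba) = arc 1`
of `D` and conversely (boundary loop `t ↦ ∂D (mark 0 - t)`, marks `0` and `1 + mark 0 - mark 1`).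
[folklore] -/
theorem exists_orientationReversed (D : DobrushinDomain) :
    ∃ D' : DobrushinDomain, D'.carrier = D.carrier ∧ D'.pt 0 = D.pt 0 ∧ D'.pt 1 = D.pt 1 ∧
      D'.arc 0 = D.arc 1 ∧ D'.arc 1 = D.arc 0 := by
  have h01 : D.mark 0 < D.mark 1 := D.strictMono_mark (show (0 : Fin 2) < 1 by decide)
  have hm1 : D.mark 1 < 1 := (D.mark_mem 1).2
  have hm0 : 0 ≤ D.mark 0 := (D.mark_mem 0).1
  let D' : DobrushinDomain :=
    { carrier := D.carrier
      boundary := fun t => D.boundary (D.mark 0 - t)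
      isOpen := D.isOpen
      isBounded := D.isBounded
      isConnected := D.isConnected
      continuous_boundary := D.continuous_boundary.comp (continuous_const.sub continuous_id)
      periodic_boundary := fun t => by
        show D.boundary (D.mark 0 - (t + 1)) = D.boundary (D.mark 0 - t)
        rw [show D.mark 0 - (t + 1) = (D.mark 0 - t) - 1 by ring]
        exact D.periodic_boundary.sub_eq (D.mark 0 - t)
      injOn_boundary := by
        intro s hs t ht h
        obtain ⟨z, hz⟩ := exists_int_of_boundary_eq D.toJordanDomain h
        have h1 : (-1 : ℝ) < ((z : ℤ) : ℝ) := by linarith [hs.1, hs.2, ht.1, ht.2]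
        have h2 : ((z : ℤ) : ℝ) < 1 := by linarith [hs.1, hs.2, ht.1, ht.2]
        have hz1 : (-1 : ℤ) < z := by exact_mod_cast h1
        have hz2 : z < 1 := by exact_mod_cast h2
        have hz0 : z = 0 := by omega
        rw [hz0, Int.cast_zero] at hz
        linarith
      range_boundary := by
        have hsurj : Function.Surjective fun t : ℝ => D.mark 0 - t :=
          fun y => ⟨D.mark 0 - y, sub_sub_cancel _ _⟩
        rw [show (fun t => D.boundary (D.mark 0 - t)) = D.boundary ∘ fun t => D.mark 0 - t from rfl,
          hsurj.range_comp]
        exact D.range_boundary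
      mark := ![0, 1 + D.mark 0 - D.mark 1]
      strictMono_mark := by
        refine Fin.strictMono_iff_lt_succ.2 fun k => ?_
        fin_cases k
        show (0 : ℝ) < 1 + D.mark 0 - D.mark 1
        linarith
      mark_mem := by
        intro k
        fin_cases k
        · exact ⟨le_rfl, zero_lt_one⟩
        · show 1 + D.mark 0 - D.mark 1 ∈ Ico (0 : ℝ) 1
          exact ⟨by linarith, by linarith⟩ }
  have hb : ∀ t, D'.boundary t = D.boundary (D.mark 0 - t) := fun t => rfl
  have hbf : D'.boundary = fun t => D.boundary (D.mark 0 - t) := rfl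
  have hk0 : D'.mark 0 = 0 := rfl
  have hk1 : D'.mark 1 = 1 + D.mark 0 - D.mark 1 := rfl
  refine ⟨D', rfl, ?_, ?_, ?_, ?_⟩
  · show D'.boundary (D'.mark 0) = D.boundary (D.mark 0)
    rw [hb, hk0, sub_zero]
  · show D'.boundary (D'.mark 1) = D.boundary (D.mark 1)
    rw [hb, hk1, show D.mark 0 - (1 + D.mark 0 - D.mark 1) = D.mark 1 - 1 by ring]
    exact D.periodic_boundary.sub_eq (D.mark 1)
  · show D'.boundary '' Icc (D'.mark 0) (D'.nextMark 0) = D.boundary '' Icc (D.mark 1) (D.nextMark 1)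
    rw [MarkedDomain.nextMark_zero_two, MarkedDomain.nextMark_one_two, hk0, hk1, hbf,
      ← image_image D.boundary (fun t => D.mark 0 - t), image_const_sub_Icc,
      image_boundary_Icc_add_one D.toJordanDomain (D.mark 0 - (1 + D.mark 0 - D.mark 1))
        (D.mark 0 - 0)]
    congr 2 <;> ring
  · show D'.boundary '' Icc (D'.mark 1) (D'.nextMark 1) = D.boundary '' Icc (D.mark 0) (D.nextMark 0)
    rw [MarkedDomain.nextMark_zero_two, MarkedDomain.nextMark_one_two, hk0, hk1, hbf,
      ← image_image D.boundary (fun t => D.mark 0 - t), image_const_sub_Icc,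
      image_boundary_Icc_add_one D.toJordanDomain (D.mark 0 - (0 + 1))
        (D.mark 0 - (1 + D.mark 0 - D.mark 1))]
    congr 2 <;> ring

/-! ### What the hands-off hypothesis pins for the twin: the wiring is swapped -/

/-- The interface map `bondInterfaceIn` reads the Dobrushin structure only through its two marked
points (the endpoint rule `orientCurve`). [folklore] -/
theorem bondInterfaceIn_eq_of_pt_eq {D D' : DobrushinDomain} (h0 : D'.pt 0 = D.pt 0)
    (h1 : D'.pt 1 = D.pt 1) (X : DiscreteDobrushin) (ω : BondConfig (Site 2)) :
    bondInterfaceIn D' X ω = bondInterfaceIn D X ω := by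
  simp only [bondInterfaceIn_apply, orientCurve, h0, h1]

/-- **Swapping the data arcs discretises the twin.** If `E` is a `ℤ²`-discretisation family of
`(D; a, b)` and `D'` is a Dobrushin structure with the same carrier and marked points and the two
arcs exchanged, then the data with `arcA ↔ arcB` exchanged form a `ℤ²`-discretisation family of
`D'` (admissibility `IsZdAdmissible` is symmetric in the two arcs; the `A`–`B` edges are the
same). Its interfaces are the bond-`ℤ²` explorations of `D` WITH THE WIRED ARC SWAPPED. [folklore] -/
theorem zdDiscretisationFamily_arcSwap {D D' : DobrushinDomain} (hc : D'.carrier = D.carrier)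
    (h0 : D'.pt 0 = D.pt 0) (h1 : D'.pt 1 = D.pt 1) (hA : D'.arc 0 = D.arc 1)
    (hB : D'.arc 1 = D.arc 0) {E : ℝ → DiscreteDobrushin} (h : ZdDiscretisationFamily D E) :
    ZdDiscretisationFamily D' (fun δ => ⟨(E δ).Ω, (E δ).δ, (E δ).arcB, (E δ).arcA⟩) := by
  have hA' : ∀ δ, DiscreteDobrushin.zdArcA ⟨(E δ).Ω, (E δ).δ, (E δ).arcB, (E δ).arcA⟩ = (E δ).zdArcB :=
    fun δ => rfl
  have hB' : ∀ δ, DiscreteDobrushin.zdArcB ⟨(E δ).Ω, (E δ).δ, (E δ).arcB, (E δ).arcA⟩ = (E δ).zdArcA :=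
    fun δ => rfl
  have hbd : ∀ δ, DiscreteDobrushin.zdBoundary ⟨(E δ).Ω, (E δ).δ, (E δ).arcB, (E δ).arcA⟩ =
      (E δ).zdBoundary := fun δ => rfl
  have hAB : ∀ δ, DiscreteDobrushin.zdABEdges ⟨(E δ).Ω, (E δ).δ, (E δ).arcB, (E δ).arcA⟩ =
      (E δ).zdABEdges := by
    intro δ
    ext e
    simp only [DiscreteDobrushin.mem_zdABEdges_iff, hA', hB']
    constructor
    · rintro ⟨he, hx, hy⟩; exact ⟨he, hy, hx⟩
    · rintro ⟨he, hx, hy⟩; exact ⟨he, hy, hx⟩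
  have hinner : ∀ δ f, DiscreteDobrushin.IsInnerFace ⟨(E δ).Ω, (E δ).δ, (E δ).arcB, (E δ).arcA⟩ f ↔
      (E δ).IsInnerFace f := fun δ f => Iff.rfl
  refine
    { Ω_eq := fun δ => (h.Ω_eq δ).trans hc.symm
      δ_eq := fun δ => h.δ_eq δ
      tendsto_arcA := by simpa only [hA] using h.tendsto_arcB
      tendsto_arcB := by simpa only [hB] using h.tendsto_arcA
      tendsto_zdABEdges := by simpa only [hAB, h0, h1] using h.tendsto_zdABEdges
      eventually_isZdAdmissible := ?_ }
  filter_upwards [h.eventually_isZdAdmissible] with δ hadm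
  exact
    { isBounded := hadm.isBounded
      delta_pos := hadm.delta_pos
      zdArcA_nonempty := by rw [hA']; exact hadm.zdArcB_nonempty
      zdArcB_nonempty := by rw [hB']; exact hadm.zdArcA_nonempty
      disjoint := by rw [hA', hB']; exact hadm.disjoint.symm
      zdBoundary_subset := by
        rw [hA', hB', hbd, Set.union_comm]; exact hadm.zdBoundary_subset
      ncard_zdABEdges_eq_two := by rw [hAB]; exact hadm.ncard_zdABEdges_eq_two
      zdABEdges_inner := by
        intro e he
        rw [hAB] at he
        simpa only [hinner] using hadm.zdABEdges_inner e he }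

/-- From the hands-off hypothesis of the stubs (joint convergence, here only its second marginal):
along a quad-convergent mesh sequence the `(ab)`-wired interface statistics of `D` converge to
those of the decoded law `(Ψ D)_* μ`. [folklore] -/
theorem tendsto_stat_of_handsOff
    (Ψ : DobrushinDomain → QuadConfig (Set.univ : Set ℂ) → CurveClass ℂ)
    (hmeas : ∀ D : DobrushinDomain, Measurable (Ψ D))
    (h3 : ∀ (μ : FiniteMeasure (QuadConfig (Set.univ : Set ℂ))) (δs : ℕ → ℝ), (∀ n, 0 < δs n) →
      Tendsto δs atTop (𝓝 0) →
      Tendsto (fun n => z2QuadLaw (Set.univ : Set ℂ) (δs n)) atTop (𝓝 μ) →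
      ∀ (D : DobrushinDomain) (E : ℝ → DiscreteDobrushin), ZdDiscretisationFamily D E →
        ∀ f : (QuadConfig (Set.univ : Set ℂ) × CurveClass ℂ) →ᵇ ℝ,
          Tendsto (fun n => ∫ ω, f (z2QuadConfig (Set.univ : Set ℂ) (δs n) ω,
              bondInterfaceIn D (E (δs n)) ω) ∂(bondPercolation (zdGraph 2) half))
            atTop (𝓝 (∫ S, f (S, Ψ D S) ∂(μ : Measure (QuadConfig (Set.univ : Set ℂ))))))
    (μ : FiniteMeasure (QuadConfig (Set.univ : Set ℂ))) (δs : ℕ → ℝ) (hpos : ∀ n, 0 < δs n)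
    (hlim : Tendsto δs atTop (𝓝 0))
    (hquad : Tendsto (fun n => z2QuadLaw (Set.univ : Set ℂ) (δs n)) atTop (𝓝 μ))
    (D : DobrushinDomain) (E : ℝ → DiscreteDobrushin) (hE : ZdDiscretisationFamily D E)
    (g : CurveClass ℂ →ᵇ ℝ) :
    Tendsto (fun n => ∫ ω, g (bondInterfaceIn D (E (δs n)) ω) ∂(bondPercolation (zdGraph 2) half))
      atTop (𝓝 (∫ γ, g γ ∂((μ : Measure (QuadConfig (Set.univ : Set ℂ))).map (Ψ D)))) := by
  have h := h3 μ δs hpos hlim hquad D E hE (g.compContinuous ⟨Prod.snd, continuous_snd⟩)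
  rw [integral_map (hmeas D).aemeasurable g.continuous.aestronglyMeasurable]
  simpa only [BoundedContinuousFunction.compContinuous_apply, ContinuousMap.coe_mk,
    Function.comp_apply] using h

/-- **The hands-off hypothesis pins the SWAPPED wiring for the twin.** With `D'` the
orientation-reversed twin of `D` (same carrier and marked points, arcs exchanged), the hands-off
hypothesis applied to `(D', arc-swapped data)` says: the statistics of the bond-`ℤ²` exploration
of `D` with the wired arc swapped (`(ba)` open, `(ab)` dual-wired) converge, along every
quad-convergent mesh sequence, to those of the decoded law `(Ψ D')_* μ`. [folklore] -/
theorem tendsto_swappedStat_of_handsOff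
    (Ψ : DobrushinDomain → QuadConfig (Set.univ : Set ℂ) → CurveClass ℂ)
    (hmeas : ∀ D : DobrushinDomain, Measurable (Ψ D))
    (h3 : ∀ (μ : FiniteMeasure (QuadConfig (Set.univ : Set ℂ))) (δs : ℕ → ℝ), (∀ n, 0 < δs n) →
      Tendsto δs atTop (𝓝 0) →
      Tendsto (fun n => z2QuadLaw (Set.univ : Set ℂ) (δs n)) atTop (𝓝 μ) →
      ∀ (D : DobrushinDomain) (E : ℝ → DiscreteDobrushin), ZdDiscretisationFamily D E →
        ∀ f : (QuadConfig (Set.univ : Set ℂ) × CurveClass ℂ) →ᵇ ℝ,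
          Tendsto (fun n => ∫ ω, f (z2QuadConfig (Set.univ : Set ℂ) (δs n) ω,
              bondInterfaceIn D (E (δs n)) ω) ∂(bondPercolation (zdGraph 2) half))
            atTop (𝓝 (∫ S, f (S, Ψ D S) ∂(μ : Measure (QuadConfig (Set.univ : Set ℂ))))))
    (μ : FiniteMeasure (QuadConfig (Set.univ : Set ℂ))) (δs : ℕ → ℝ) (hpos : ∀ n, 0 < δs n)
    (hlim : Tendsto δs atTop (𝓝 0))
    (hquad : Tendsto (fun n => z2QuadLaw (Set.univ : Set ℂ) (δs n)) atTop (𝓝 μ))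
    {D D' : DobrushinDomain} (hc : D'.carrier = D.carrier) (h0 : D'.pt 0 = D.pt 0)
    (h1 : D'.pt 1 = D.pt 1) (hA : D'.arc 0 = D.arc 1) (hB : D'.arc 1 = D.arc 0)
    (E : ℝ → DiscreteDobrushin) (hE : ZdDiscretisationFamily D E) (g : CurveClass ℂ →ᵇ ℝ) :
    Tendsto (fun n => ∫ ω, g (bondInterfaceIn D
        ⟨(E (δs n)).Ω, (E (δs n)).δ, (E (δs n)).arcB, (E (δs n)).arcA⟩ ω)
          ∂(bondPercolation (zdGraph 2) half))
      atTop (𝓝 (∫ γ, g γ ∂((μ : Measure (QuadConfig (Set.univ : Set ℂ))).map (Ψ D')))) := by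
  have h := tendsto_stat_of_handsOff Ψ hmeas h3 μ δs hpos hlim hquad D'
    (fun δ => ⟨(E δ).Ω, (E δ).δ, (E δ).arcB, (E δ).arcA⟩)
    (zdDiscretisationFamily_arcSwap hc h0 h1 hA hB hE) g
  simpa only [bondInterfaceIn_eq_of_pt_eq h0 h1] using h

/-- **Core consequence.** If the decoded family gives the twin the same law as `D`
(`(Ψ D')_* μ = (Ψ D)_* μ` — forced by `IsLocal` and by `IsDomainMarkov`, above), then the
`(ab)`-wired and the `(ba)`-wired interface statistics of `D` have the SAME limit along every
quad-convergent mesh sequence. [folklore] -/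
theorem wiringSwap_sameLimit_of_map_eq
    (Ψ : DobrushinDomain → QuadConfig (Set.univ : Set ℂ) → CurveClass ℂ)
    (hmeas : ∀ D : DobrushinDomain, Measurable (Ψ D))
    (h3 : ∀ (μ : FiniteMeasure (QuadConfig (Set.univ : Set ℂ))) (δs : ℕ → ℝ), (∀ n, 0 < δs n) →
      Tendsto δs atTop (𝓝 0) →
      Tendsto (fun n => z2QuadLaw (Set.univ : Set ℂ) (δs n)) atTop (𝓝 μ) →
      ∀ (D : DobrushinDomain) (E : ℝ → DiscreteDobrushin), ZdDiscretisationFamily D E →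
        ∀ f : (QuadConfig (Set.univ : Set ℂ) × CurveClass ℂ) →ᵇ ℝ,
          Tendsto (fun n => ∫ ω, f (z2QuadConfig (Set.univ : Set ℂ) (δs n) ω,
              bondInterfaceIn D (E (δs n)) ω) ∂(bondPercolation (zdGraph 2) half))
            atTop (𝓝 (∫ S, f (S, Ψ D S) ∂(μ : Measure (QuadConfig (Set.univ : Set ℂ))))))
    (μ : FiniteMeasure (QuadConfig (Set.univ : Set ℂ))) (δs : ℕ → ℝ) (hpos : ∀ n, 0 < δs n)
    (hlim : Tendsto δs atTop (𝓝 0))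
    (hquad : Tendsto (fun n => z2QuadLaw (Set.univ : Set ℂ) (δs n)) atTop (𝓝 μ))
    {D D' : DobrushinDomain} (hc : D'.carrier = D.carrier) (h0 : D'.pt 0 = D.pt 0)
    (h1 : D'.pt 1 = D.pt 1) (hA : D'.arc 0 = D.arc 1) (hB : D'.arc 1 = D.arc 0)
    (hmap : (μ : Measure (QuadConfig (Set.univ : Set ℂ))).map (Ψ D') =
      (μ : Measure (QuadConfig (Set.univ : Set ℂ))).map (Ψ D))
    (E : ℝ → DiscreteDobrushin) (hE : ZdDiscretisationFamily D E) (g : CurveClass ℂ →ᵇ ℝ) :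
    Tendsto (fun n =>
        (∫ ω, g (bondInterfaceIn D (E (δs n)) ω) ∂(bondPercolation (zdGraph 2) half)) -
          ∫ ω, g (bondInterfaceIn D ⟨(E (δs n)).Ω, (E (δs n)).δ, (E (δs n)).arcB, (E (δs n)).arcA⟩ ω)
            ∂(bondPercolation (zdGraph 2) half))
      atTop (𝓝 0) := by
  have hab := tendsto_stat_of_handsOff Ψ hmeas h3 μ δs hpos hlim hquad D E hE g
  have hba := tendsto_swappedStat_of_handsOff Ψ hmeas h3 μ δs hpos hlim hquad hc h0 h1 hA hB E hE g
  rw [hmap] at hba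
  have h := hab.sub hba
  rwa [sub_self] at h

/-- `IsLocal` version: if the decoded family is LOCAL (the `IsLocal` conjunct concluded by
STUB 6), the two wirings of every admissible family have the same limiting statistics along every
quad-convergent sequence. [folklore] -/
theorem wiringSwap_sameLimit_of_isLocal
    (Ψ : DobrushinDomain → QuadConfig (Set.univ : Set ℂ) → CurveClass ℂ)
    (hmeas : ∀ D : DobrushinDomain, Measurable (Ψ D))
    (h3 : ∀ (μ : FiniteMeasure (QuadConfig (Set.univ : Set ℂ))) (δs : ℕ → ℝ), (∀ n, 0 < δs n) →
      Tendsto δs atTop (𝓝 0) →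
      Tendsto (fun n => z2QuadLaw (Set.univ : Set ℂ) (δs n)) atTop (𝓝 μ) →
      ∀ (D : DobrushinDomain) (E : ℝ → DiscreteDobrushin), ZdDiscretisationFamily D E →
        ∀ f : (QuadConfig (Set.univ : Set ℂ) × CurveClass ℂ) →ᵇ ℝ,
          Tendsto (fun n => ∫ ω, f (z2QuadConfig (Set.univ : Set ℂ) (δs n) ω,
              bondInterfaceIn D (E (δs n)) ω) ∂(bondPercolation (zdGraph 2) half))
            atTop (𝓝 (∫ S, f (S, Ψ D S) ∂(μ : Measure (QuadConfig (Set.univ : Set ℂ))))))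
    (μ : FiniteMeasure (QuadConfig (Set.univ : Set ℂ))) (δs : ℕ → ℝ) (hpos : ∀ n, 0 < δs n)
    (hlim : Tendsto δs atTop (𝓝 0))
    (hquad : Tendsto (fun n => z2QuadLaw (Set.univ : Set ℂ) (δs n)) atTop (𝓝 μ))
    (hloc : ChordalFamily.IsLocal
      (fun G => (μ : Measure (QuadConfig (Set.univ : Set ℂ))).map (Ψ G)))
    (D : DobrushinDomain) (E : ℝ → DiscreteDobrushin) (hE : ZdDiscretisationFamily D E)
    (g : CurveClass ℂ →ᵇ ℝ) :
    Tendsto (fun n =>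
        (∫ ω, g (bondInterfaceIn D (E (δs n)) ω) ∂(bondPercolation (zdGraph 2) half)) -
          ∫ ω, g (bondInterfaceIn D ⟨(E (δs n)).Ω, (E (δs n)).δ, (E (δs n)).arcB, (E (δs n)).arcA⟩ ω)
            ∂(bondPercolation (zdGraph 2) half))
      atTop (𝓝 0) := by
  obtain ⟨D', hc, h0, h1, hA, hB⟩ := exists_orientationReversed D
  exact wiringSwap_sameLimit_of_map_eq Ψ hmeas h3 μ δs hpos hlim hquad hc h0 h1 hA hB
    (eq_of_isLocal_of_carrier_eq hloc hc h0 h1) E hE g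

/-- `IsDomainMarkov` version: the same conclusion from the set-based domain Markov property of the
decoded family (the conclusion of STUB 7), through `initial` + `domain`. [folklore] -/
theorem wiringSwap_sameLimit_of_isDomainMarkov
    (Ψ : DobrushinDomain → QuadConfig (Set.univ : Set ℂ) → CurveClass ℂ)
    (hmeas : ∀ D : DobrushinDomain, Measurable (Ψ D))
    (h3 : ∀ (μ : FiniteMeasure (QuadConfig (Set.univ : Set ℂ))) (δs : ℕ → ℝ), (∀ n, 0 < δs n) →
      Tendsto δs atTop (𝓝 0) →
      Tendsto (fun n => z2QuadLaw (Set.univ : Set ℂ) (δs n)) atTop (𝓝 μ) →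
      ∀ (D : DobrushinDomain) (E : ℝ → DiscreteDobrushin), ZdDiscretisationFamily D E →
        ∀ f : (QuadConfig (Set.univ : Set ℂ) × CurveClass ℂ) →ᵇ ℝ,
          Tendsto (fun n => ∫ ω, f (z2QuadConfig (Set.univ : Set ℂ) (δs n) ω,
              bondInterfaceIn D (E (δs n)) ω) ∂(bondPercolation (zdGraph 2) half))
            atTop (𝓝 (∫ S, f (S, Ψ D S) ∂(μ : Measure (QuadConfig (Set.univ : Set ℂ))))))
    (μ : FiniteMeasure (QuadConfig (Set.univ : Set ℂ))) (δs : ℕ → ℝ) (hpos : ∀ n, 0 < δs n)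
    (hlim : Tendsto δs atTop (𝓝 0))
    (hquad : Tendsto (fun n => z2QuadLaw (Set.univ : Set ℂ) (δs n)) atTop (𝓝 μ))
    (hmk : ChordalFamily.IsDomainMarkov
      (fun G => (μ : Measure (QuadConfig (Set.univ : Set ℂ))).map (Ψ G)))
    (D : DobrushinDomain) (E : ℝ → DiscreteDobrushin) (hE : ZdDiscretisationFamily D E)
    (g : CurveClass ℂ →ᵇ ℝ) :
    Tendsto (fun n =>
        (∫ ω, g (bondInterfaceIn D (E (δs n)) ω) ∂(bondPercolation (zdGraph 2) half)) -
          ∫ ω, g (bondInterfaceIn D ⟨(E (δs n)).Ω, (E (δs n)).δ, (E (δs n)).arcB, (E (δs n)).arcA⟩ ω)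
            ∂(bondPercolation (zdGraph 2) half))
      atTop (𝓝 0) := by
  obtain ⟨D', hc, h0, h1, hA, hB⟩ := exists_orientationReversed D
  -- `IsDomainMarkov` alone ⇒ `P D' = P D` for the same `(carrier, a, b)`: `P G = Q G (const a)` by
  -- `initial`, and `Q G past` reads `G` only through `(remainingDomain G past, G.pt 1)` by `domain`
  -- (cf. `CardyRotToConfR2SymmetryUpgrade.Negative.eq_of_isDomainMarkov_of_carrier_eq`, crux 0698).
  have hrem : ∀ past : CurveClass ℂ, remainingDomain D' past = remainingDomain D past := by
    intro past
    simp only [remainingDomain, hc, h1]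
  have key : ∀ {P : ChordalFamily}, P.IsDomainMarkov → P D' = P D := by
    intro P hP
    obtain ⟨Q, hQ⟩ := hP
    rw [← hQ.initial D', ← hQ.initial D, h0]
    exact hQ.domain D' D _ _ (hrem _) rfl h1
  exact wiringSwap_sameLimit_of_map_eq Ψ hmeas h3 μ δs hpos hlim hquad hc h0 h1 hA hB (key hmk) E hE g

end Summit.CriticalPhenomena.CardyFormulaZ2.Theorems.LagHandOff.Negative

end
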